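import Mathlib.Analysis.ODE.PicardLindelof
import Literature.Geometry.Lorentzian.OpensChartGeodesic
import HarnessLib

/-!
# The geodesic equations of a metric on an open subset of a normed space, necessity; the
# Euler–Lagrange (momentum) form; smoothness of geodesics
(trunk G08 = T-LORENTZ; namespace `Literature.Geometry.Lorentzian.OpensChart`)

`OpensChartGeodesic.lean` proves the "if" direction of O'Neill's Cor. 3.21 in the single chart
`U : Opens E` of a `C^n` metric `g` with components `G` (`g.val y = G y`): a curve whose coordinate
expression solves `c'' + Γ(c', c') = 0` is a geodesic. This file proves the converse and the two
consequences of the coordinate equations that the Gaussian-beam construction along a *given*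
geodesic needs (Sbierski, Anal. PDE 8 (2015), §3: "`γ` is a null geodesic, thus it satisfies the
equations of the geodesic flow on `T*M`", arXiv:1311.2477v2 (2.17)/(2.20)):

* `OpensChart.hasDerivAt_of_isGeodesicOn` (O'Neill 1983, Ch. 3, Cor. 21, "only if"): if
  `γ : ℝ → U` is a geodesic of `g.leviCivita` on `s`, then at every `t ∈ s` the coordinate curve
  `t ↦ (γ t : E)` has derivative the velocity `γ'(t)`, and the velocity has derivative
  `−Γ_{γ t}(γ'(t), γ'(t))` — the computation of `GeodesicProofs.lean`
  (`hasDerivAt_oneJet_of_covariantDerivAlong_eq_zero`) read in the identity trivialisation of `TU`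
  with the constant coordinate frame (`OpensChart.localFrame_trivializationAt`,
  `OpensChart.leviCivita_const_apply`);
* `OpensChart.hasDerivAt_momentum_of_isGeodesicOn` (O'Neill 1983, Ch. 3, proof of Prop. 13 with
  Cor. 21; the Euler–Lagrange equations of `L = ½ g(ċ, ċ)`, equivalently Hamilton's equation
  `ṗ_μ = −∂H/∂x^μ` for `H = ½ g^{μν} p_μ p_ν` written with `∂_μ g⁻¹ = −g⁻¹ (∂_μ g) g⁻¹`): along a
  geodesic the momenta `p_Z(t) = g_{γ t}(γ'(t), Z)`, `Z ∈ E` fixed, satisfy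
  `ṗ_Z = ½ (∂_Z G)(γ')(γ', γ')`, for symmetric differentiable components `G`;
* `OpensChart.contDiffAt_of_isGeodesicOn` (O'Neill 1983, Ch. 3, Lemma 22: geodesics come from
  "the existence and uniqueness theorem for ordinary differential equations", hence are as smooth
  as the Christoffel data): if `(y, v) ↦ Γ_y(v, v)` agrees on `U × E` with a map `C^∞` there, the
  coordinate curve and the velocity of a geodesic on an open parameter set are `C^∞` at each of its
  points (Mathlib's `ODE.contDiffOn_enat_Icc_of_hasDerivWithinAt` for the first-order system of the
  1-jet on small compact parameter intervals).

## References

* B. O'Neill, *Semi-Riemannian geometry with applications to relativity*, Academic Press 1983,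
  Ch. 3: Prop. 13, Cor. 21, Lemma 22 (key `ONeill1983`).
* J. Sbierski, Anal. PDE 8 (2015) 1379–1420, §3 (arXiv:1311.2477v2 §2.2, (2.17), (2.20)) (key
  `Sbierski2015`).
-/

noncomputable section

open Bundle Set Filter TopologicalSpace
open scoped Manifold ContDiff Topology

namespace Literature.Geometry.Lorentzian

namespace OpensChart

variable {E : Type*} [NormedAddCommGroup E] [NormedSpace ℝ E] [FiniteDimensional ℝ E]
  {U : Opens E} {n : ℕ∞ω}
  {g : PseudoRiemannianMetric 𝓘(ℝ, E) n E (TangentSpace 𝓘(ℝ, E) : U → Type _)}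
  {G : E → E →L[ℝ] E →L[ℝ] ℝ}

/-! ### Necessity of the coordinate geodesic equations -/

/-- **The geodesic equations in the chart `U`, necessity** (O'Neill 1983, Ch. 3, Cor. 21, "only if"
direction). Let `g` be a metric on `U : Opens E` with its Levi-Civita connection and with
components `G` (`g.val y = G y`) differentiable at every point, and let `γ : ℝ → U` be a geodesic of
`g.leviCivita` on `s`. Then at every `t ∈ s` the coordinate curve `t ↦ (γ t : E)` has derivative
`γ'(t)` and the velocity `t ↦ γ'(t)` has derivative `−Γ_{γ t}(γ'(t), γ'(t))`, `Γ` the Christoffel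
map of the components (`OpensChart.christoffel`). [cite: ONeill1983, Ch. 3, Cor. 21] -/
theorem hasDerivAt_of_isGeodesicOn [g.HasLeviCivita] (hG : ∀ y : U, g.val y = G y)
    (hGd : ∀ y : U, DifferentiableAt ℝ G y) {γ : ℝ → U} {s : Set ℝ}
    (hγ : IsGeodesicOn g.leviCivita γ s) {t : ℝ} (ht : t ∈ s) :
    HasDerivAt (fun t' ↦ (γ t' : E)) (velocity 𝓘(ℝ, E) γ t) t ∧
    HasDerivAt (fun t' ↦ (velocity 𝓘(ℝ, E) γ t' : E))
      (-christoffel g G (γ t) (velocity 𝓘(ℝ, E) γ t) (velocity 𝓘(ℝ, E) γ t)) t := by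
  set x₁ : U := γ t with hx₁_def
  set b := Module.finBasis ℝ E with hb_def
  -- the Christoffel data of the chart: `Ĉᵢ(y) w = ∇_w bᵢ = Γ_y(w, bᵢ)`
  set Ĉ : Fin (Module.finrank ℝ E) → U → (E →L[ℝ] E) := fun i y ↦ christoffel g G y (b i)
    with hĈ_def
  have hN : (univ : Set U) ⊆ (chartAt E x₁).source := fun y _ ↦ by simp [chartAt_source]
  have hĈ : ∀ y ∈ (univ : Set U), ∀ (i) (w : TangentSpace 𝓘(ℝ, E) y),
      Ĉ i y ((trivializationAt E (TangentSpace 𝓘(ℝ, E)) x₁).continuousLinearMapAt ℝ y w) =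
        ((trivializationAt E (TangentSpace 𝓘(ℝ, E)) x₁)
          ⟨y, g.leviCivita ((trivializationAt E (TangentSpace 𝓘(ℝ, E)) x₁).localFrame b i)
            y w⟩).2 := by
    intro y _ i w
    rw [continuousLinearMapAt_trivializationAt_apply, trivializationAt_apply,
      localFrame_trivializationAt]
    exact (leviCivita_const_apply hG y (hGd y) (b i) w).symm
  have h := hasDerivAt_oneJet_of_covariantDerivAlong_eq_zero (cov := g.leviCivita) b hN Ĉ hĈ
    (mem_univ (γ t)) (hγ.1 t ht) (hγ.2 t ht)
  -- read the 1-jet in the identity trivialisation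
  have hjet : (fun t' ↦ ((extChartAt 𝓘(ℝ, E) x₁ (γ t'),
      (trivializationAt E (TangentSpace 𝓘(ℝ, E)) x₁ (tangentLift 𝓘(ℝ, E) γ t')).2) : E × E)) =
      fun t' ↦ ((γ t' : E), (velocity 𝓘(ℝ, E) γ t' : E)) := by
    funext t'
    rw [extChartAt_apply, show tangentLift 𝓘(ℝ, E) γ t' = ⟨γ t', velocity 𝓘(ℝ, E) γ t'⟩ from rfl,
      trivializationAt_apply]
    rfl
  have hw : ((trivializationAt E (TangentSpace 𝓘(ℝ, E)) x₁) (tangentLift 𝓘(ℝ, E) γ t)).2 =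
      velocity 𝓘(ℝ, E) γ t := by
    rw [show tangentLift 𝓘(ℝ, E) γ t = ⟨γ t, velocity 𝓘(ℝ, E) γ t⟩ from rfl, trivializationAt_apply]
  have hsum : ∑ i, b.repr (velocity 𝓘(ℝ, E) γ t) i • Ĉ i (γ t) (velocity 𝓘(ℝ, E) γ t) =
      christoffel g G (γ t) (velocity 𝓘(ℝ, E) γ t) (velocity 𝓘(ℝ, E) γ t) := by
    simp only [hĈ_def]
    rw [← christoffel_sum, b.sum_repr]
  rw [hjet, hw, hsum] at h
  exact ⟨(ContinuousLinearMap.fst ℝ E E).hasFDerivAt.comp_hasDerivAt t h,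
    (ContinuousLinearMap.snd ℝ E E).hasFDerivAt.comp_hasDerivAt t h⟩

/-- On a geodesic, the coordinate velocity is the derivative of the coordinate curve:
`deriv (γ : E) t = γ'(t)` for `t ∈ s`. [cite: ONeill1983, Ch. 3, Cor. 21] -/
theorem deriv_val_of_isGeodesicOn [g.HasLeviCivita] (hG : ∀ y : U, g.val y = G y)
    (hGd : ∀ y : U, DifferentiableAt ℝ G y) {γ : ℝ → U} {s : Set ℝ}
    (hγ : IsGeodesicOn g.leviCivita γ s) {t : ℝ} (ht : t ∈ s) :
    deriv (fun t' ↦ (γ t' : E)) t = velocity 𝓘(ℝ, E) γ t :=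
  (hasDerivAt_of_isGeodesicOn hG hGd hγ ht).1.deriv

/-! ### The momentum (Euler–Lagrange) form of the geodesic equations -/

omit [FiniteDimensional ℝ E] in
/-- The derivative of symmetric metric components is symmetric:
`DG(x)(v)(A, B) = DG(x)(v)(B, A)`. [folklore] -/
theorem fderiv_apply₂_symm (hsymm : ∀ y : E, ∀ A B : E, G y A B = G y B A) {x : E}
    (hGx : DifferentiableAt ℝ G x) (v A B : E) :
    fderiv ℝ G x v A B = fderiv ℝ G x v B A := by
  rw [← fderiv_apply₂ G hGx A B v, ← fderiv_apply₂ G hGx B A v]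
  have : (fun y ↦ G y A B) = fun y ↦ G y B A := funext fun y ↦ hsymm y A B
  rw [this]

omit [FiniteDimensional ℝ E] in
/-- Expansion of `G y x Z` along a basis in the slot `x`: `G y x Z = ∑ᵢ xⁱ G y bᵢ Z`. [folklore] -/
theorem apply₂_eq_sum_repr {ι : Type*} [Fintype ι] (b : Module.Basis ι ℝ E) (y x Z : E) :
    G y x Z = ∑ i, b.repr x i * G y (b i) Z := by
  conv_lhs => rw [← b.sum_repr x]
  rw [map_sum, sum_apply]
  refine Finset.sum_congr rfl fun i _ ↦ ?_
  rw [map_smul, smul_apply, smul_eq_mul]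

/-- **The momentum form of the geodesic equations** (O'Neill 1983, Ch. 3, Prop. 13 with Cor. 21;
Sbierski 2015, §3: the geodesic "satisfies the equations of the geodesic flow on `T*M`",
`ṗ_μ = −∂_μ H`, `H = ½ g^{μν} p_μ p_ν`, i.e. `ṗ_μ = ½ (∂_μ g)(γ̇, γ̇)`). Along a geodesic `γ` of
a metric with symmetric components `G` differentiable at every point, for every fixed `Z ∈ E` the
momentum `p_Z(t) = G(γ t)(γ'(t), Z)` satisfies `ṗ_Z(t) = ½ DG(γ t)(Z)(γ'(t), γ'(t))` at every
`t ∈ s`: by the product rule `ṗ_Z = ∂_{γ'}G(γ', Z) + G(γ'', Z)`, and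
`G(γ'', Z) = −G(Γ(γ', γ'), Z) = −½ K(γ', γ', Z) = −∂_{γ'}G(γ', Z) + ½ ∂_Z G(γ', γ')`
(`OpensChart.two_mul_val_christoffel`). [cite: ONeill1983, Ch. 3, Prop. 13 and Cor. 21] -/
theorem hasDerivAt_momentum_of_isGeodesicOn [g.HasLeviCivita] (hG : ∀ y : U, g.val y = G y)
    (hGd : ∀ y : U, DifferentiableAt ℝ G y) (hsymm : ∀ y : E, ∀ A B : E, G y A B = G y B A)
    {γ : ℝ → U} {s : Set ℝ} (hγ : IsGeodesicOn g.leviCivita γ s) {t : ℝ} (ht : t ∈ s) (Z : E) :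
    HasDerivAt (fun t' ↦ G (γ t') (velocity 𝓘(ℝ, E) γ t') Z)
      ((2 : ℝ)⁻¹ * fderiv ℝ G (γ t) Z (velocity 𝓘(ℝ, E) γ t) (velocity 𝓘(ℝ, E) γ t)) t := by
  obtain ⟨hc, hv⟩ := hasDerivAt_of_isGeodesicOn hG hGd hγ ht
  set w : E := velocity 𝓘(ℝ, E) γ t with hw
  set b := Module.finBasis ℝ E with hb_def
  -- expand the velocity along the basis: `p_Z = ∑ᵢ (γ')ⁱ G(γ)(bᵢ, Z)`
  have hp : (fun t' ↦ G (γ t') (velocity 𝓘(ℝ, E) γ t') Z) =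
      fun t' ↦ ∑ i, b.repr (velocity 𝓘(ℝ, E) γ t') i * G (γ t') (b i) Z := by
    funext t'
    exact apply₂_eq_sum_repr b _ _ _
  -- the coefficients and the components are differentiable
  have hcoef : ∀ i, HasDerivAt (fun t' ↦ b.repr (velocity 𝓘(ℝ, E) γ t') i)
      (b.repr (-christoffel g G (γ t) w w) i) t := fun i ↦
    ((b.coord i).toContinuousLinearMap).hasFDerivAt.comp_hasDerivAt t hv
  have hcomp : ∀ i, HasDerivAt (fun t' ↦ G (γ t') (b i) Z) (fderiv ℝ G (γ t) w (b i) Z) t := by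
    intro i
    have h := (differentiableAt_apply₂ G (hGd (γ t)) (b i) Z).hasFDerivAt.comp_hasDerivAt t hc
    rw [fderiv_apply₂ G (hGd (γ t))] at h
    exact h
  have hsum := HasDerivAt.fun_sum fun i (_ : i ∈ Finset.univ) ↦ (hcoef i).mul (hcomp i)
  rw [hp]
  refine hsum.congr_deriv ?_
  -- collect: `∑ᵢ [(−Γ)ⁱ G(bᵢ, Z) + (γ')ⁱ ∂_{γ'}G(bᵢ, Z)] = −G(Γ, Z) + ∂_{γ'}G(γ', Z)`
  have e1 : ∑ i, b.repr (-christoffel g G (γ t) w w) i * G (γ t) (b i) Z =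
      G (γ t) (-christoffel g G (γ t) w w) Z := (apply₂_eq_sum_repr b _ _ _).symm
  have e2 : ∑ i, b.repr w i * fderiv ℝ G (γ t) w (b i) Z = fderiv ℝ G (γ t) w w Z :=
    (apply₂_eq_sum_repr (G := fun y ↦ fderiv ℝ G (γ t) y) b w w Z).symm
  have hsplit : ∑ i, (b.repr (-christoffel g G (γ t) w w) i * G (γ t) (b i) Z +
      b.repr (velocity 𝓘(ℝ, E) γ t) i * fderiv ℝ G (γ t) w (b i) Z) =
      G (γ t) (-christoffel g G (γ t) w w) Z + fderiv ℝ G (γ t) w w Z := by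
    rw [Finset.sum_add_distrib, e1, ← hw, e2]
  rw [hsplit]
  -- the value of the derivative
  have hK : 2 * G (γ t) (christoffel g G (γ t) w w) Z = koszulForm G (γ t) w w Z := by
    rw [← hG]; exact two_mul_val_christoffel (γ t) w w Z
  rw [koszulForm_apply] at hK
  have hs : fderiv ℝ G (γ t) w Z w = fderiv ℝ G (γ t) w w Z :=
    fderiv_apply₂_symm hsymm (hGd (γ t)) w Z w
  rw [hs] at hK
  simp only [map_neg, FunLike.coe_neg, Pi.neg_apply] at *
  linarith

/-! ### Smoothness of geodesics -/

/-- **Geodesics are smooth where the Christoffel data are** (O'Neill 1983, Ch. 3, Lemma 22: the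
geodesics are the solutions of the coordinate geodesic equations given by "the existence and
uniqueness theorem for ordinary differential equations"). If `Φ : E → E → E` is `C^∞` on `U × E`
and `Φ y v = Γ_y(v, v)` for `y ∈ U`, then for a geodesic `γ` on an open parameter set `s` the
coordinate curve `t ↦ (γ t : E)` and the velocity `t ↦ γ'(t)` are `C^∞` at every `t ∈ s`: the 1-jet
`(γ, γ')` solves the autonomous system `(u, w)' = (w, −Φ(u, w))` (`hasDerivAt_of_isGeodesicOn`),
whose solutions are `C^∞` on compact parameter intervals
(`ODE.contDiffOn_enat_Icc_of_hasDerivWithinAt`). [cite: ONeill1983, Ch. 3, Lemma 22] -/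
theorem contDiffAt_of_isGeodesicOn [g.HasLeviCivita] (hG : ∀ y : U, g.val y = G y)
    (hGd : ∀ y : U, DifferentiableAt ℝ G y) {Φ : E → E → E}
    (hΦ : ContDiffOn ℝ ∞ (fun q : E × E ↦ Φ q.1 q.2) ((U : Set E) ×ˢ univ))
    (hΦΓ : ∀ (y : U) (v : E), Φ y v = christoffel g G y v v) {γ : ℝ → U} {s : Set ℝ}
    (hs : IsOpen s) (hγ : IsGeodesicOn g.leviCivita γ s) {t : ℝ} (ht : t ∈ s) :
    ContDiffAt ℝ ∞ (fun t' ↦ (γ t' : E)) t ∧ ContDiffAt ℝ ∞ (fun t' ↦ (velocity 𝓘(ℝ, E) γ t' : E)) t := by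
  -- a compact parameter interval around `t` inside `s`
  obtain ⟨ε, hε, hball⟩ := Metric.isOpen_iff.1 hs t ht
  set a : ℝ := t - ε / 2 with ha
  set c : ℝ := t + ε / 2 with hc
  have hIcc : Icc a c ⊆ s := fun t' ht' ↦ hball (by
    rw [Metric.mem_ball, Real.dist_eq, abs_lt]
    constructor <;> linarith [ht'.1, ht'.2])
  have hnhds : Icc a c ∈ 𝓝 t := Icc_mem_nhds (by linarith) (by linarith)
  -- the 1-jet and the autonomous field
  set z : ℝ → E × E := fun t' ↦ ((γ t' : E), (velocity 𝓘(ℝ, E) γ t' : E)) with hz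
  set F : ℝ → E × E → E × E := fun _ q ↦ (q.2, -Φ q.1 q.2) with hF
  have hFd : ContDiffOn ℝ ∞ (Function.uncurry F) (Icc a c ×ˢ ((U : Set E) ×ˢ (univ : Set E))) := by
    have h2 : ContDiffOn ℝ ∞ (fun p : ℝ × (E × E) ↦ p.2) (Icc a c ×ˢ ((U : Set E) ×ˢ univ)) :=
      contDiffOn_snd
    have hmaps : MapsTo (fun p : ℝ × (E × E) ↦ p.2) (Icc a c ×ˢ ((U : Set E) ×ˢ univ))
        ((U : Set E) ×ˢ univ) := fun p hp ↦ hp.2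
    have hΦ' : ContDiffOn ℝ ∞ (fun p : ℝ × (E × E) ↦ Φ p.2.1 p.2.2)
        (Icc a c ×ˢ ((U : Set E) ×ˢ univ)) := hΦ.comp h2 hmaps
    have hsnd : ContDiffOn ℝ ∞ (fun p : ℝ × (E × E) ↦ p.2.2) (Icc a c ×ˢ ((U : Set E) ×ˢ univ)) :=
      contDiffOn_snd.comp h2 hmaps
    exact hsnd.prodMk hΦ'.neg
  have hzder : ∀ t' ∈ Icc a c, HasDerivWithinAt z (F t' (z t')) (Icc a c) t' := by
    intro t' ht'
    obtain ⟨h1, h2⟩ := hasDerivAt_of_isGeodesicOn hG hGd hγ (hIcc ht')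
    have h := h1.prodMk h2
    rw [← hΦΓ] at h
    exact h.hasDerivWithinAt
  have hzmem : MapsTo z (Icc a c) ((U : Set E) ×ˢ (univ : Set E)) :=
    fun t' _ ↦ ⟨(γ t').2, mem_univ _⟩
  have hzs : ContDiffOn ℝ ∞ z (Icc a c) := ODE.contDiffOn_enat_Icc_of_hasDerivWithinAt hFd hzder hzmem
  have hzt : ContDiffAt ℝ ∞ z t := hzs.contDiffAt hnhds
  exact ⟨hzt.fst, hzt.snd⟩

/-- **Geodesics on `ℝ` are smooth curves** (the case `s = ℝ` of `contDiffAt_of_isGeodesicOn`): the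
coordinate curve and the velocity of a geodesic of `g.leviCivita` are `C^∞`, provided
`(y, v) ↦ Γ_y(v, v)` agrees on `U × E` with a `C^∞` map. [cite: ONeill1983, Ch. 3, Lemma 22] -/
theorem contDiff_of_isGeodesic [g.HasLeviCivita] (hG : ∀ y : U, g.val y = G y)
    (hGd : ∀ y : U, DifferentiableAt ℝ G y) {Φ : E → E → E}
    (hΦ : ContDiffOn ℝ ∞ (fun q : E × E ↦ Φ q.1 q.2) ((U : Set E) ×ˢ univ))
    (hΦΓ : ∀ (y : U) (v : E), Φ y v = christoffel g G y v v) {γ : ℝ → U}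
    (hγ : IsGeodesic g.leviCivita γ) :
    ContDiff ℝ ∞ (fun t ↦ (γ t : E)) ∧ ContDiff ℝ ∞ (fun t ↦ (velocity 𝓘(ℝ, E) γ t : E)) :=
  ⟨contDiff_iff_contDiffAt.2 fun t ↦
      (contDiffAt_of_isGeodesicOn hG hGd hΦ hΦΓ isOpen_univ hγ (mem_univ t)).1,
    contDiff_iff_contDiffAt.2 fun t ↦
      (contDiffAt_of_isGeodesicOn hG hGd hΦ hΦΓ isOpen_univ hγ (mem_univ t)).2⟩

end OpensChart

end Literature.Geometry.Lorentzian

end
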